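/-
# Solo-blind programme on Kontsevich–Zagier, s6 part T3g: `Li₂(−1)` and the inversion formula

Two corollaries of Euler's reflection (`SoloBlindDilogEuler`) and Landen's identity
(`SoloBlindLanden`) inside the rules, with no further chart:

* **`−Li₂(−1) = π²/12` as an identity of KZ classes.**  Landen at `w = 1` gives
  `2[D⁻(1)] = 2[D(½)] + ℓ(2)²`, Euler at the self-dual cut `½` gives `[Λ₂] = 2[D(½)] + ℓ(2)²`, so
  `2·[D⁻(1)] = [Λ₂]`, `12·[D⁻(1)] = x_π²` (`twelve_mul_mkQ_dilogNegOne`): the two-dimensional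
  cell `D⁻(1) = [0 < p₁ < p₀ < 1, dp/(p₀(1+p₁))]` lies in the tame `π`-sector and in every `H₂(μ)`,
  and the Kontsevich–Zagier conjecture holds between it and `Z`, `S`, `Λ₂`, the even zeta boxes, …
  (`kz_dilogNegOne`).
* **Inversion.**  For real algebraic `w > 1` the Landen cuts of `w` and `1/w` are reflections of
  each other (`u(1/w) = 1 − u(w)`), so Landen twice and Euler once give
  `2·[D⁻(w)] + 2·[D⁻(1/w)] = 2·[Λ₂] + ℓ(w)²` in `Q` (`inversion_mkQ_dilogNeg`), with period shadow
  `Li₂(−w) + Li₂(−1/w) = −π²/6 − ½log²w` (`dilogNeg_inv_value`).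
-/
import Summits.KontsevichZagierPeriods.KontsevichZagierPeriods.Theorems.SoloBlindLanden
import Summits.KontsevichZagierPeriods.KontsevichZagierPeriods.Theorems.SoloBlindHomogeneous

noncomputable section

open MeasureTheory Set
open Literature.NumberTheory.Transcendental
open Literature.NumberTheory.Transcendental.KZ
open Literature.NumberTheory.Transcendental.KZ.IntegralRep

namespace Summit.KontsevichZagierPeriods.KontsevichZagierPeriods.Theorems

namespace SoloBlind

/-! ## Euler at a Landen cut -/

section euler

variable {w : ℝ} (hw : IsAlgebraic ℚ w) (h0 : 0 < w)

/-- `1/u = 1 + 1/w` for the Landen cut `u = w/(1+w)`. -/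
theorem Cut.inv_ofPos_x : (Cut.ofPos hw h0).x⁻¹ = 1 + w⁻¹ := by
  rw [Cut.ofPos_x, mul_inv, inv_inv]
  field_simp
  ring

/-- Euler's reflection at the Landen cut: `[Λ₂] = [D(u)] + [D(1−u)] + ℓ(1+1/w)·ℓ(1+w)`. -/
theorem mkQ_simplexTwo_ofPos : mkQ (of simplexTwo) = mkQ (of (dilogCut (Cut.ofPos hw h0))) +
    mkQ (of (dilogCut (Cut.ofPos hw h0).symm)) + ell (1 + w⁻¹) * ell (1 + w) := by
  rw [← Cut.inv_ofPos_x hw h0, ← Cut.inv_one_sub_ofPos_x hw h0]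
  exact mkQ_simplexTwo_cut _

end euler

/-! ## `Li₂(−1)`: the cell `D⁻(1)` -/

/-- **The cell `D⁻(1) = [0 < p₁ < p₀ < 1, dp/(p₀(1+p₁))]`**, period `−Li₂(−1) = Σ(−1)^{n+1}/n²`. -/
abbrev dilogNegOne : IntegralRep 2 := dilogNeg isAlgebraic_one one_pos

/-- The Landen cut of `w = 1` is the self-dual cut `½`. -/
theorem ofPos_one_symm :
    (Cut.ofPos isAlgebraic_one one_pos).symm = Cut.ofPos isAlgebraic_one one_pos :=
  Cut.ext (by show 1 - 1 * (1 + 1 : ℝ)⁻¹ = 1 * (1 + 1 : ℝ)⁻¹; norm_num)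

/-- **`2·[D⁻(1)] = [Λ₂]`** in `Q`. -/
theorem two_mul_mkQ_dilogNegOne : 2 * mkQ (of dilogNegOne) = mkQ (of simplexTwo) := by
  have hL := two_nsmul_mkQ_dilogNeg isAlgebraic_one one_pos
  have hE := mkQ_simplexTwo_ofPos isAlgebraic_one one_pos
  rw [ofPos_one_symm, inv_one] at hE
  simp only [nsmul_eq_mul, Nat.cast_ofNat] at hL
  linear_combination hL - hE

/-- **`12·[D⁻(1)] = x_π²`** in `Q`: `−Li₂(−1) = π²/12` as an identity of classes. -/
theorem twelve_mul_mkQ_dilogNegOne : 12 * mkQ (of dilogNegOne) = xPi ^ 2 := by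
  have hZ : 6 * mkQ (of zetaTwoRep) = xPi ^ 2 := by
    rw [← six_smul_mkQ_zetaTwoRep, ofNat_smul_eq_nsmul, nsmul_eq_mul, Nat.cast_ofNat]
  have h2 := two_mul_mkQ_dilogNegOne
  rw [mkQ_eq_mkQ_iff.2 simplexTwo_equiv_zetaTwoRep] at h2
  linear_combination 6 * h2 + hZ

/-- `[D⁻(1)] = x_π²/12`. -/
theorem mkQ_dilogNegOne : mkQ (of dilogNegOne) = (12 : K₀)⁻¹ • xPi ^ 2 := by
  rw [eq_inv_smul_iff₀ (by norm_num : (12 : K₀) ≠ 0), ← twelve_mul_mkQ_dilogNegOne,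
    ofNat_smul_eq_nsmul, nsmul_eq_mul, Nat.cast_ofNat]

/-- `D⁻(1)` lies in the tame `π`-sector `B(π)`. -/
theorem dilogNegOne_mem_piSector : of dilogNegOne ∈ piSector := by
  rw [mem_piSector, mkQ_dilogNegOne]
  exact Subalgebra.smul_mem _ (Subalgebra.pow_mem _ (Algebra.self_mem_adjoin_singleton K₀ xPi) 2) _

/-- `D⁻(1)` lies in every homogeneous sector `H₂(μ)`. -/
theorem dilogNegOne_mem_homSector (μ : ℝ) : of dilogNegOne ∈ homSector μ 2 := by
  refine mem_modSector_of_mkQ_eq (Fin.last 2) (12 : K₀)⁻¹ ?_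
  rw [mkQ_dilogNegOne, homGen]
  simp

/-- **The Kontsevich–Zagier conjecture holds between `D⁻(1)` and every representation of the
`π`-sector** (`Z`, `S`, `Λ₂`, the even zeta and odd Dirichlet boxes, the tangent cells, …). -/
theorem kz_dilogNegOne {m : ℕ} (r' : IntegralRep m) (hr' : of r' ∈ piSector)
    (hv : dilogNegOne.value = r'.value) : Equivalent dilogNegOne r' :=
  kz_piSector _ _ dilogNegOne_mem_piSector hr' hv

/-- **`−Li₂(−1) = π²/12`**: the period of `D⁻(1)`, read off the moves. -/
theorem dilogNegOne_value : dilogNegOne.value = Real.pi ^ 2 / 12 := by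
  have h := congrArg evalQ twelve_mul_mkQ_dilogNegOne
  rw [map_mul, map_pow, evalQ_xPi, evalQ_mkQ, eval_of, map_ofNat] at h
  linarith

/-! ## Inversion -/

section inversion

variable {w : ℝ} (hw : IsAlgebraic ℚ w) (h1 : 1 < w)

/-- The Landen cut of `1/w` is the reflection of the Landen cut of `w`. -/
theorem ofPos_inv : Cut.ofPos hw.inv (inv_pos.2 (by linarith : 0 < w)) =
    (Cut.ofPos hw (by linarith)).symm :=
  Cut.ext (by
    show w⁻¹ * (1 + w⁻¹)⁻¹ = 1 - w * (1 + w)⁻¹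
    have h0 : w ≠ 0 := by linarith
    field_simp
    ring)

include hw h1 in
/-- `ℓ(1 + 1/w) = ℓ(1+w) − ℓ(w)` for `w > 1` (log-linearity inside the rules, Baker not needed). -/
theorem ell_one_add_inv : ell (1 + w⁻¹) = ell (1 + w) - ell w := by
  have hw0 : 0 < w := by linarith
  have h := ell_eq_sum_smul ((isAlgebraic_one.add hw.inv))
    (by simpa using inv_pos.2 hw0) ![1 + w, w] (fun k => by
      fin_cases k
      · exact isAlgebraic_one.add hw
      · exact hw) (fun k => by fin_cases k <;> simp <;> linarith) ![1, -1] (by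
      rw [Fin.sum_univ_two]
      simp only [Matrix.cons_val_zero, Matrix.cons_val_one, Rat.cast_one, Rat.cast_neg, one_mul,
        neg_one_mul]
      rw [← sub_eq_add_neg, ← Real.log_div (by linarith) hw0.ne', add_div, div_self hw0.ne',
        one_div, add_comm])
  rw [h, Fin.sum_univ_two]
  simp only [Matrix.cons_val_zero, Matrix.cons_val_one, Rat.cast_one, Rat.cast_neg, one_smul,
    neg_smul, ← sub_eq_add_neg]

/-- **Inversion as an identity of KZ classes.** For every real algebraic `w > 1`:
`2·[D⁻(w)] + 2·[D⁻(1/w)] = 2·[Λ₂] + ℓ(w)²` in `Q`. -/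
theorem inversion_mkQ_dilogNeg :
    2 * mkQ (of (dilogNeg hw (by linarith : 0 < w))) +
        2 * mkQ (of (dilogNeg hw.inv (inv_pos.2 (by linarith : 0 < w)))) =
      2 * mkQ (of simplexTwo) + ell w ^ 2 := by
  have hL := two_nsmul_mkQ_dilogNeg hw (by linarith : 0 < w)
  have hL' := two_nsmul_mkQ_dilogNeg hw.inv (inv_pos.2 (by linarith : 0 < w))
  have hE := mkQ_simplexTwo_ofPos hw (by linarith : 0 < w)
  rw [ofPos_inv hw h1] at hL'
  rw [ell_one_add_inv hw h1] at hE hL'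
  simp only [nsmul_eq_mul, Nat.cast_ofNat] at hL hL'
  linear_combination hL + hL' + (-2) * hE

/-- **`Li₂(−w) + Li₂(−1/w) = −π²/6 − ½log²w`** (`w > 1` real algebraic), read off the moves:
`value D⁻(w) + value D⁻(1/w) = π²/6 + log²w/2`. -/
theorem dilogNeg_inv_value : (dilogNeg hw (by linarith : 0 < w)).value +
    (dilogNeg hw.inv (inv_pos.2 (by linarith : 0 < w))).value =
      Real.pi ^ 2 / 6 + Real.log w ^ 2 / 2 := by
  have h := congrArg evalQ (inversion_mkQ_dilogNeg hw h1)
  rw [map_add, map_add, map_mul, map_mul, map_mul, map_pow, evalQ_mkQ, evalQ_mkQ, evalQ_mkQ,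
    eval_of, eval_of, eval_of, simplexTwo_value, evalQ_ell hw h1.le, map_ofNat] at h
  linarith

end inversion

end SoloBlind

end Summit.KontsevichZagierPeriods.KontsevichZagierPeriods.Theorems
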